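import Literature.MathematicalPhysics.QuantumFieldTheory.Balaban1983to89.B9Eq349ConjugatedDPBlockDecay
import Literature.MathematicalPhysics.QuantumFieldTheory.Balaban1983to89.B9Eq349KWAssembly

/-!
# `Balaban1983to89.B9Eq349QtildeBlockLetters` — T. Bałaban, *Propagators for lattice gauge theories in a background field*, Commun. Math. Phys.
# **99** (1985) 389–434 [Balaban1985BackgroundPropagators] (3.19) p. 393 with (3.26) p. 395 and (3.49) p. 399: **THE BLOCK LETTERS OF THE ONE-STEP
# AVERAGING `Q̃′(U)` BETWEEN THE FINE `L`-BLOCKS AND THE COARSE POINTS — `1_{y} ∘ Q̃′(U) ∘ 1_{Δ(y′)} = 0` for `y ≠ y′` (the average over `B(y)`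
# reads `B(y)` only), the diagonal sizes `‖1_{y} ∘ Q̃′(U) ∘ 1_{Δ(y)}‖ ≤ ‖Q̃′(U)‖ ≤ P√(c₁∕(c₀L^d))`, `‖1_{y} ∘ (Q̃′(U) − Q̃′(1)) ∘ 1_{Δ(y)}‖ ≤
# (P − 1)√(c₁∕(c₀L^d))` (`P = (1 + 2M_φM_φ′ε_U)^{d(L−1)}`), and the same three letters for the ADJOINT `Q̃′(U)†` with the blocks transposed** — the
# `Q`∕`Q♮` hypotheses of (S3b) `B9Eq349QGGQPerturbationLetters.norm_block_QGGQ_sub_le(_torus)` AT THE LATTICE; route R2′ STEP B8′, road B8″ sub-step S3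
# of the pub-balaban NE9 chain, instance-ledger row L9 (S3e, first half: the `Q`-letters; the `H`-letter `Δ′(U) − Δ′(1)` is the sequel's)

statement-level skeleton of published theorems with citation tags; proofs where landed; nothing here is a claim about the Yang–Mills mass gap

CITATION HEADER (lean-in-tree rule).  Audit cell `pub-balaban`, sub-cell `t4`, BINDER row NE9; filed by NE9 formalisation-swarm LEAF PROVER 01
(`b2b-balaban-t4-ne9-formalise-leaf-01`, gen 84), composing BY NAME: `B9Eq3101ConjugationLetters.QprimeLin_apply_eq_sum` ((3.19) unfolded: the sum
over `B(y)`), `B9Eq3101ConjugationLettersChain.QprimeW_eq_QprimeLin`, the cell's `B9Thm311SitePrimeFormCoerciveCanonical.norm_Qtilde_flat_le` ∕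
`norm_Qtilde_sub_flat_le` (flat count + deviation), `B9Eq384RemainderLetters.norm_adTransportW_sub_le` (the transporter letter `ε_R = 2M_φM_φ′ε_U`), (K1)
`B9Eq349BlockMultipliers` (block letters, `opNorm_block_le`), (K4b) `B9Eq349KWAssembly.adjoint_eq_self_of_pointwise` (real pointwise symbols are
self-adjoint).  ROUTE LOCUS: `t4/ROUTES-NE9.md` v13.37∕v13.38∕v13.39 §L1.2 ADDENDUM (ii) road B8″ S3 — (S3b) takes `Q := Q̃′(U)`, `Q₁ := Q̃′(1)`,
`Q♮ := Q̃′(U)†`, `Q♮₁ := Q̃′(1)†` block-DIAGONAL with sizes `M_Q`, `β_Q`; this file discharges those eight hypotheses at the chain.  Source READ in the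
held text [Balaban1985BackgroundPropagators]: p. 393 (3.19) *«(Q′(V)λ)(y) = Σ_{x∈B(y)} L^{−d}R(V(Γ_{y,x}))λ(x)»*; p. 395 (3.26); p. 399 (3.49).  NOTHING
of print's estimates is asserted.

WHAT IS PROVED (sorry-free; proof lane — no `def`; [folklore] finite sums and adjoints BY NAME).
* §1 **`point_comp_Qtilde_comp_block_eq_zero`** — `r_y ∘L Q̃′(U) ∘L P_{y′} = 0` for `y ≠ y′` (coarse point family `r`, fine block family `P`, (K1)'s letters).
* §2 `norm_point_comp_comp_block_le_opNorm` (`‖r_y ∘L T ∘L P_{y′}‖ ≤ ‖T‖`), **`norm_point_comp_Qtilde_comp_block_le`** (`≤ P·√(c₁∕(c₀L^d))`),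
  **`norm_point_comp_Qtilde_sub_comp_block_le`** (`≤ (P − 1)·√(c₁∕(c₀L^d))`).
* §3 THE ADJOINT: `adjoint_block_eq_self` (block projections are self-adjoint), **`block_comp_adjoint_Qtilde_comp_point_eq_zero`**,
  **`norm_block_comp_adjoint_comp_point_le`** (`‖P_{y′} ∘L T† ∘L r_y‖ = ‖r_y ∘L T ∘L P_{y′}‖`-bounded: the transposed letters for `Q♮ = Q̃′(U)†`, `Q♮ − Q♮₁`).
HONEST SCOPE.  Bookkeeping; the sizes are the cell's flat count + deviation letters, unevaluated; ONE half (the `Q`-letters) of ONE instance (S3e) of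
a sub-step, NOT NE9 (cell pub-balaban: NE9 NOT PRINTED ∕ NOT PROVED; «NE9 ⇐ the named binders»; row WALLED ON A MODEL (O-NE9-1; #5 UNRULED); spine
PROVED 0∕9; rung (B)+1 on a finite T⁴ — NOT infinite volume, NOT mass gap, NOT Clay; HONEST DEPENDENCY: continuum YM on T⁴ ⇐ BetaPertH ∧ nine spine
estimates (0/9 proved); BetaPertH ⇐ (D1) ∧ (D4) ∧ CAP+tail; G-an2-4 gates asym, D1 and NE2/3/4).  NEW file importing (K3) only; nothing modified.
Net new unproved facts: 0.
-/

noncomputable section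

set_option autoImplicit false

open scoped InnerProductSpace ComplexConjugate BigOperators

namespace Literature.MathematicalPhysics.QuantumFieldTheory.Balaban1983to89.B9Eq349QtildeBlockLetters

open B4Sect5Torus (TSite)
open B9SectCLatticeCarrier (Bond)
open B9Eq311L2Pairing (WL2)
open B9Eq319QprimeTorus (fineP blockCoord mem_blockOf_iff)
open B11Eq103H1Complex (SiteL2K)
open B7Prop1Explicit (U1)
open B9Eq310HessianOperator (adTransportW)
open B9Eq326OperatorAssembly (QprimeW)
open B9Eq3101ConjugationLetters (QprimeLin_apply_eq_sum)
open B9Eq3101ConjugationLettersChain (QprimeW_eq_QprimeLin)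
open B9Eq384RemainderLetters (norm_adTransportW_sub_le)
open B9Thm311SitePrimeFormCoerciveCanonical (norm_Qtilde_flat_le norm_Qtilde_sub_flat_le)
open B9Eq349BlockMultipliers (opNorm_block_le)
open B9Eq349KWAssembly (adjoint_eq_self_of_pointwise)

variable {d : ℕ} {L : ℕ} [NeZero L] {m : Fin d → ℕ} {𝔸 : Type*} [NormedRing 𝔸] [NormedAlgebra ℂ 𝔸] [NormOneClass 𝔸]
  {W : Type*} [NormedAddCommGroup W] [InnerProductSpace ℂ W] [FiniteDimensional ℂ W] {φ : W ≃ₗ[ℂ] 𝔸}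
  {c₀ : ℝ} [Fact (0 < c₀)] {c₁ : ℝ} [Fact (0 < c₁)]
  {r : TSite d m → SiteL2K ℂ d m c₁ W →L[ℂ] SiteL2K ℂ d m c₁ W}
  (hr : ∀ (y : TSite d m) (g : SiteL2K ℂ d m c₁ W) (z : TSite d m),
    WL2.equiv ℂ (fun _ : TSite d m => c₁) W (r y g) z = if z = y then WL2.equiv ℂ (fun _ : TSite d m => c₁) W g z else 0)
  {P : TSite d m → SiteL2K ℂ d (fineP L m) c₀ W →L[ℂ] SiteL2K ℂ d (fineP L m) c₀ W}
  (hP : ∀ (y : TSite d m) (f : SiteL2K ℂ d (fineP L m) c₀ W) (x : TSite d (fineP L m)),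
    WL2.equiv ℂ (fun _ : TSite d (fineP L m) => c₀) W (P y f) x =
      if blockCoord L m x = y then WL2.equiv ℂ (fun _ : TSite d (fineP L m) => c₀) W f x else 0)

/-! ## §1 The average over `B(y)` reads `B(y)` only -/

omit [NormOneClass 𝔸] in
include hr hP in
/-- **`r_y ∘ Q̃′(U) ∘ P_{y′} = 0` FOR `y ≠ y′`**: `(Q̃′(U)λ)(y) = Σ_{x∈B(y)} L^{−d}R(U(Γ_{y,x}))λ(x)` ((3.19)) and `(P_{y′}f)(x) = 0` off `B(y′)`.
[cite: Balaban1985BackgroundPropagators, (3.19) p.393, (3.49) p.399 «x ∈ Δ(y), supp f ⊂ Δ(y′)»] -/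
theorem point_comp_Qtilde_comp_block_eq_zero (U : Bond d (fineP L m) → 𝔸ˣ) {y y' : TSite d m} (hyy : y ≠ y') :
    r y ∘L LinearMap.toContinuousLinearMap ((WL2.linearEquiv ℂ ℂ (fun _ : TSite d m => c₁)).symm.toLinearMap ∘ₗ QprimeW L m φ U (c₀ := c₀)) ∘L P y' = 0 := by
  ext f
  have h0 : (0 : SiteL2K ℂ d (fineP L m) c₀ W →L[ℂ] SiteL2K ℂ d m c₁ W) f = 0 := rfl
  rw [h0]
  apply (WL2.equiv ℂ (fun _ : TSite d m => c₁) W).injective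
  funext z
  rw [ContinuousLinearMap.comp_apply, ContinuousLinearMap.comp_apply, hr, WL2.equiv_zero, Pi.zero_apply]
  by_cases hz : z = y
  · rw [if_pos hz, LinearMap.coe_toContinuousLinearMap', LinearMap.comp_apply, hz]
    change ((WL2.linearEquiv ℂ ℂ (fun _ : TSite d m => c₁)).symm (QprimeW L m φ U (c₀ := c₀) (P y' f))) y = 0
    rw [WL2.linearEquiv_symm_apply, WL2.equiv_symm_apply, QprimeW_eq_QprimeLin, QprimeLin_apply_eq_sum]
    refine Finset.sum_eq_zero fun x hx => ?_
    have hxy : blockCoord L m x = y := (mem_blockOf_iff L m y x).mp hx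
    have hPx : WL2.equiv ℂ (fun _ : TSite d (fineP L m) => c₀) W (P y' f) x = 0 := by
      rw [hP, if_neg]; rw [hxy]; exact hyy
    rw [hPx, map_zero, smul_zero]
  · rw [if_neg hz]

/-! ## §2 Sizes of the diagonal blocks -/

omit [NeZero L] [FiniteDimensional ℂ W] in
include hr hP in
/-- `‖r_y ∘ T ∘ P_{y′}‖ ≤ ‖T‖` for ANY `T` (both families contract). [folklore] [cite: Balaban1985BackgroundPropagators, (3.49) p.399] -/
theorem norm_point_comp_comp_block_le_opNorm (T : SiteL2K ℂ d (fineP L m) c₀ W →L[ℂ] SiteL2K ℂ d m c₁ W) (y y' : TSite d m) :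
    ‖r y ∘L T ∘L P y'‖ ≤ ‖T‖ :=
  calc ‖r y ∘L T ∘L P y'‖ ≤ ‖r y‖ * (‖T‖ * ‖P y'‖) :=
        (ContinuousLinearMap.opNorm_comp_le _ _).trans (mul_le_mul_of_nonneg_left (ContinuousLinearMap.opNorm_comp_le _ _) (norm_nonneg _))
    _ ≤ 1 * (‖T‖ * 1) :=
        mul_le_mul (opNorm_block_le hr y) (mul_le_mul_of_nonneg_left (opNorm_block_le hP y') (norm_nonneg T)) (by positivity) zero_le_one
    _ = ‖T‖ := by ring

variable {Mφ Mφ' : ℝ} (hφ : ∀ w, ‖φ w‖ ≤ Mφ * ‖w‖) (hφ' : ∀ X, ‖φ.symm X‖ ≤ Mφ' * ‖X‖) (hMφ : 0 ≤ Mφ) (hMφ' : 0 ≤ Mφ')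
  {U : Bond d (fineP L m) → 𝔸ˣ} (hU : ∀ b, U b ∈ U1 𝔸) {εU : ℝ} (hεU : 0 ≤ εU) (hUε : ∀ b, ‖(U b : 𝔸) - 1‖ ≤ εU)

include hr hP hφ hφ' hMφ hMφ' hU hεU hUε in
/-- **THE DIAGONAL SIZE `M_Q`**: `‖r_y ∘ Q̃′(U) ∘ P_{y′}‖ ≤ (1 + 2M_φM_φ′ε_U)^{d(L−1)}·√(c₁∕(c₀L^d))` (flat count `norm_Qtilde_flat_le` + deviation
`norm_Qtilde_sub_flat_le` through the transporter letter `norm_adTransportW_sub_le`). [cite: Balaban1985BackgroundPropagators, (3.19) p.393, (3.35) p.396, (3.49) p.399] -/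
theorem norm_point_comp_Qtilde_comp_block_le (y y' : TSite d m) :
    ‖r y ∘L LinearMap.toContinuousLinearMap ((WL2.linearEquiv ℂ ℂ (fun _ : TSite d m => c₁)).symm.toLinearMap ∘ₗ QprimeW L m φ U (c₀ := c₀)) ∘L P y'‖ ≤
      (1 + 2 * Mφ * Mφ' * εU) ^ (d * (L - 1)) * Real.sqrt (c₁ / (c₀ * (L : ℝ) ^ d)) := by
  have hεR : 0 ≤ 2 * Mφ * Mφ' * εU := by positivity
  have hR : ∀ (b : Bond d (fineP L m)) (w : W), ‖adTransportW φ U b w - w‖ ≤ 2 * Mφ * Mφ' * εU * ‖w‖ := fun b w =>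
    norm_adTransportW_sub_le φ hφ hφ' hMφ' U b (hU b) (hUε b) w
  refine (norm_point_comp_comp_block_le_opNorm hr hP _ y y').trans (ContinuousLinearMap.opNorm_le_bound _ (by positivity) fun lam => ?_)
  rw [LinearMap.coe_toContinuousLinearMap']
  have h1 := norm_Qtilde_flat_le L m φ (c₀ := c₀) (c₁ := c₁) lam
  have h2 := norm_Qtilde_sub_flat_le L m φ U (c₀ := c₀) (c₁ := c₁) hεR hR lam
  calc _ ≤ ‖((WL2.linearEquiv ℂ ℂ (fun _ : TSite d m => c₁)).symm.toLinearMap ∘ₗ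
            QprimeW L m φ (fun _ : Bond d (fineP L m) => (1 : 𝔸ˣ)) (c₀ := c₀)) lam‖ + ‖_ - _‖ := norm_le_insert' _ _
    _ ≤ Real.sqrt (c₁ / (c₀ * (L : ℝ) ^ d)) * ‖lam‖ +
          ((1 + 2 * Mφ * Mφ' * εU) ^ (d * (L - 1)) - 1) * Real.sqrt (c₁ / (c₀ * (L : ℝ) ^ d)) * ‖lam‖ := add_le_add h1 h2
    _ = (1 + 2 * Mφ * Mφ' * εU) ^ (d * (L - 1)) * Real.sqrt (c₁ / (c₀ * (L : ℝ) ^ d)) * ‖lam‖ := by ring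

include hr hP hφ hφ' hMφ hMφ' hU hεU hUε in
/-- **THE DIFFERENCE SIZE `β_Q`**: `‖r_y ∘ (Q̃′(U) − Q̃′(1)) ∘ P_{y′}‖ ≤ ((1 + 2M_φM_φ′ε_U)^{d(L−1)} − 1)·√(c₁∕(c₀L^d))` — rows L3∕L5's Lipschitz letter
`norm_Qtilde_sub_flat_le`, `∝ ε_U`. [cite: Balaban1985BackgroundPropagators, (3.19) p.393, (3.35) p.396, (3.49) p.399] -/
theorem norm_point_comp_Qtilde_sub_comp_block_le (y y' : TSite d m) :
    ‖r y ∘L (LinearMap.toContinuousLinearMap ((WL2.linearEquiv ℂ ℂ (fun _ : TSite d m => c₁)).symm.toLinearMap ∘ₗ QprimeW L m φ U (c₀ := c₀)) -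
        LinearMap.toContinuousLinearMap ((WL2.linearEquiv ℂ ℂ (fun _ : TSite d m => c₁)).symm.toLinearMap ∘ₗ
          QprimeW L m φ (fun _ : Bond d (fineP L m) => (1 : 𝔸ˣ)) (c₀ := c₀))) ∘L P y'‖ ≤
      ((1 + 2 * Mφ * Mφ' * εU) ^ (d * (L - 1)) - 1) * Real.sqrt (c₁ / (c₀ * (L : ℝ) ^ d)) := by
  have hεR : 0 ≤ 2 * Mφ * Mφ' * εU := by positivity
  have hR : ∀ (b : Bond d (fineP L m)) (w : W), ‖adTransportW φ U b w - w‖ ≤ 2 * Mφ * Mφ' * εU * ‖w‖ := fun b w =>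
    norm_adTransportW_sub_le φ hφ hφ' hMφ' U b (hU b) (hUε b) w
  have hP1 : 0 ≤ (1 + 2 * Mφ * Mφ' * εU) ^ (d * (L - 1)) - 1 := sub_nonneg.mpr (one_le_pow₀ (by linarith [mul_nonneg (mul_nonneg hMφ hMφ') hεU]))
  refine (norm_point_comp_comp_block_le_opNorm hr hP _ y y').trans (ContinuousLinearMap.opNorm_le_bound _ (by positivity) fun lam => ?_)
  rw [FunLike.coe_sub, Pi.sub_apply, LinearMap.coe_toContinuousLinearMap', LinearMap.coe_toContinuousLinearMap']
  exact norm_Qtilde_sub_flat_le L m φ U (c₀ := c₀) (c₁ := c₁) hεR hR lam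

/-! ## §3 The adjoint `Q̃′(U)†`: transposed letters -/

omit [NeZero L] in
include hr in
/-- the coarse point projections are self-adjoint (real pointwise symbol `1_{· = y}`; (K4b) `adjoint_eq_self_of_pointwise`). [folklore]
[cite: Balaban1985BackgroundPropagators, (3.11) p.392] -/
theorem adjoint_point_eq_self (y : TSite d m) : ContinuousLinearMap.adjoint (r y) = r y :=
  adjoint_eq_self_of_pointwise (id : TSite d m → TSite d m) (r y) (fun z => if z = y then (1 : ℝ) else 0) fun g z => by
    rw [hr]; by_cases hz : z = y
    · simp [hz]
    · simp [hz]

omit [NeZero L] in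
include hP in
/-- the fine block projections are self-adjoint (real pointwise symbol `1_{blk · = y}`). [folklore] [cite: Balaban1985BackgroundPropagators, (3.11) p.392] -/
theorem adjoint_block_eq_self (y : TSite d m) : ContinuousLinearMap.adjoint (P y) = P y :=
  adjoint_eq_self_of_pointwise (blockCoord L m) (P y) (fun z => if z = y then (1 : ℝ) else 0) fun f x => by
    rw [hP]; by_cases hx : blockCoord L m x = y
    · simp [hx]
    · simp [hx]

omit [NeZero L] in
include hr hP in
/-- **TRANSPOSITION**: `P_{y′} ∘ T† ∘ r_y = (r_y ∘ T ∘ P_{y′})†`, hence it vanishes when `r_y ∘ T ∘ P_{y′}` does and has the same norm. [folklore]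
[cite: Balaban1985BackgroundPropagators, (3.26) p.395, (3.49) p.399] -/
theorem block_comp_adjoint_comp_point_eq (T : SiteL2K ℂ d (fineP L m) c₀ W →L[ℂ] SiteL2K ℂ d m c₁ W) (y y' : TSite d m) :
    P y' ∘L ContinuousLinearMap.adjoint T ∘L r y = ContinuousLinearMap.adjoint (r y ∘L T ∘L P y') := by
  rw [ContinuousLinearMap.adjoint_comp, ContinuousLinearMap.adjoint_comp, adjoint_point_eq_self hr, adjoint_block_eq_self hP,
    ContinuousLinearMap.comp_assoc]

omit [NormOneClass 𝔸] in
include hr hP in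
/-- `P_{y′} ∘ Q̃′(U)† ∘ r_y = 0` for `y ≠ y′`. [cite: Balaban1985BackgroundPropagators, (3.19) p.393, (3.26) p.395] -/
theorem block_comp_adjoint_Qtilde_comp_point_eq_zero (U : Bond d (fineP L m) → 𝔸ˣ) {y y' : TSite d m} (hyy : y ≠ y') :
    P y' ∘L ContinuousLinearMap.adjoint (LinearMap.toContinuousLinearMap
        ((WL2.linearEquiv ℂ ℂ (fun _ : TSite d m => c₁)).symm.toLinearMap ∘ₗ QprimeW L m φ U (c₀ := c₀))) ∘L r y = 0 := by
  rw [block_comp_adjoint_comp_point_eq hr hP, point_comp_Qtilde_comp_block_eq_zero hr hP U hyy, map_zero]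

omit [NeZero L] in
include hr hP in
/-- `‖P_{y′} ∘ T† ∘ r_y‖ ≤ C` whenever `‖r_y ∘ T ∘ P_{y′}‖ ≤ C` (the adjoint is an isometry). [folklore] [cite: Balaban1985BackgroundPropagators, (3.26) p.395] -/
theorem norm_block_comp_adjoint_comp_point_le (T : SiteL2K ℂ d (fineP L m) c₀ W →L[ℂ] SiteL2K ℂ d m c₁ W) (y y' : TSite d m) {C : ℝ}
    (hC : ‖r y ∘L T ∘L P y'‖ ≤ C) : ‖P y' ∘L ContinuousLinearMap.adjoint T ∘L r y‖ ≤ C := by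
  rw [block_comp_adjoint_comp_point_eq hr hP, LinearIsometryEquiv.norm_map]
  exact hC

end Literature.MathematicalPhysics.QuantumFieldTheory.Balaban1983to89.B9Eq349QtildeBlockLetters

end
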